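import Literature.Analysis.FluidPDE.SverakLandauConformal
import Literature.Analysis.FluidPDE.SverakLandauObataCalculus
import HarnessLib

/-!
# Šverák's classification of `(−1)`-homogeneous steady Navier–Stokes flows — the Liouville equation for `Ψ = e^{−Φ/2}`

Analysis/FluidPDE support file of the series `SverakLandau*` proving the named fact
`Literature.Analysis.FluidPDE.Sverak2011_landauClassification` (V. Šverák, J. Math. Sci. 179
(2011) = arXiv:math/0604550, Thm. 1).

Šverák's (E4): `−Δφ + 2 = 2e^φ` on `S²`.  In the `ℝ³ ∖ {0}` rendering, with the `0`-homogeneous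
potential `Φ` of `SverakLandauConformal` (`∇Φ = v`-part, `2 + ⟪x, u⟫ = 2e^Φ`, so
`ΔΦ = div v = −f/r² = −(2e^Φ − 2)/r²`) and `Ψ = e^{−Φ/2}`, the equation becomes
`r²(ΨΔΨ − |∇Ψ|²) + Ψ² = 1`.  This file derives it, Euler's relations for `Ψ` and its first two
derivatives, and the differentiated equation, on the shell `{c/4 < |y|}` for the globally smooth
`Ψr = e^{−Φr/2}` built from the regularised potential of `Sverak2011.conformal_setup`:

* `Sverak2011.obata_setup` — for every `c > 0`: a smooth nowhere-vanishing `Ψr`, equal to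
  `e^{−Φ/2}` on `{c/4 ≤ |y|}`, with `⟪y, ∇Ψr⟫ = 0`, `∇²Ψr y = −∇Ψr`, `∇³Ψr(y,·,·) = −2∇²Ψr`,
  `r²(Ψr ΔΨr − |∇Ψr|²) + Ψr² = 1` and its gradient, all on `{c/4 < |y|}` (coordinates
  `∂ₗ = pderiv l`).

## References

* V. Šverák, *On Landau's solutions of the Navier–Stokes equations*, J. Math. Sci. 179 (2011)
  208–228, arXiv:math/0604550, §4, (E4). [`Sverak2011`]
-/

noncomputable section

open Set Filter Metric
open scoped Topology BigOperators ContDiff Laplacian RealInnerProductSpace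

namespace Literature.Analysis.FluidPDE

namespace Sverak2011

/-- Partials of `log Ψ` and of `−2 log Ψ`'s Laplacian pieces: for smooth nowhere-vanishing `Ψ`,
`∂ₗ(log Ψ) = Ψ⁻¹∂ₗΨ` and `∂ₗ∂ₗ(log Ψ) = −Ψ⁻²(∂ₗΨ)² + Ψ⁻¹∂ₗ∂ₗΨ`. [folklore] -/
theorem pderiv_pderiv_log {Ψ : EuclideanSpace ℝ (Fin 3) → ℝ} (hΨ : ContDiff ℝ ∞ Ψ)
    (hΨ0 : ∀ x, Ψ x ≠ 0) (l : Fin 3) (x : EuclideanSpace ℝ (Fin 3)) :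
    pderiv l (fun y => Real.log (Ψ y)) = (fun y => (Ψ y)⁻¹ * pderiv l Ψ y) ∧
    pderiv l (pderiv l fun y => Real.log (Ψ y)) x =
      -((Ψ x) ^ 2)⁻¹ * pderiv l Ψ x * pderiv l Ψ x + (Ψ x)⁻¹ * pderiv l (pderiv l Ψ) x := by
  have hΨd : Differentiable ℝ Ψ := hΨ.differentiable (by simp)
  have h1 : pderiv l (fun y => Real.log (Ψ y)) = fun y => (Ψ y)⁻¹ * pderiv l Ψ y := by
    funext y
    rw [pderiv_apply, ((hΨd y).hasFDerivAt.log (hΨ0 y)).fderiv]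
    simp [pderiv_apply]
  refine ⟨h1, ?_⟩
  obtain ⟨hd, hp⟩ := pderiv_inv_of_ne_zero (g := fun m => pderiv m Ψ) hΨ hΨ0 (fun _ => rfl) l
  rw [h1, pderiv_mul hd ((contDiff_pderiv hΨ l).differentiable (by simp))]
  beta_reduce
  rw [hp]

variable {u : EuclideanSpace ℝ (Fin 3) → EuclideanSpace ℝ (Fin 3)} {p : EuclideanSpace ℝ (Fin 3) → ℝ}

/-- **The Liouville equation for `Ψ = e^{−Φ/2}` and Euler's relations, on a shell** (Šverák 2011,
(E4) `−Δφ + 2 = 2e^φ`, bulk form `r²(ΨΔΨ − |∇Ψ|²) + Ψ² = 1`).  For the data of Theorem 1, a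
potential `Φ` as in `exists_conformal_potential`, and `c > 0`, there is a smooth nowhere-vanishing
`Ψr : ℝ³ → ℝ` with `Ψr = e^{−Φ/2}` on `{c/4 ≤ |y|}` such that on `{c/4 < |y|}`:
`∑ⱼ yⱼ∂ⱼΨr = 0`, `∑ⱼ yⱼ∂ⱼ∂ₘΨr = −∂ₘΨr`, `∑ⱼ yⱼ∂ⱼ∂ₗ∂ₘΨr = −2∂ₗ∂ₘΨr`,
`r²(Ψr∑ₗ∂ₗ∂ₗΨr − ∑ₗ(∂ₗΨr)²) + Ψr² = 1`, and the `∂ⱼ`-derivative of the latter. [cite: Sverak2011, §4 (E4)] -/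
theorem obata_setup (hu : ContDiffOn ℝ ∞ u {x | x ≠ 0}) (hp : ContDiffOn ℝ ∞ p {x | x ≠ 0})
    (hns : ∀ x, x ≠ 0 → -(Δ u) x + convect u u x + gradient p x = 0)
    (hdiv : ∀ x, x ≠ 0 → VectorCalculus.divergence u x = 0)
    (hhom : ∀ (t : ℝ) (x : EuclideanSpace ℝ (Fin 3)), 0 < t → x ≠ 0 → t • u (t • x) = u x)
    {Φ : EuclideanSpace ℝ (Fin 3) → ℝ} (hΦs : ContDiffOn ℝ ∞ Φ {x | x ≠ 0})
    (hΦ : ∀ x : EuclideanSpace ℝ (Fin 3), x ≠ 0 →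
      HasFDerivAt Φ (innerSL ℝ (u x - (⟪x, u x⟫ / ‖x‖ ^ 2) • x)) x)
    (hΦF : ∀ x : EuclideanSpace ℝ (Fin 3), x ≠ 0 → 2 + ⟪x, u x⟫ = 2 * Real.exp (Φ x))
    {c : ℝ} (hc : 0 < c) :
    ∃ Ψr : EuclideanSpace ℝ (Fin 3) → ℝ, ContDiff ℝ ∞ Ψr ∧ (∀ y, Ψr y ≠ 0) ∧ (∀ y, 0 < Ψr y) ∧
      (∀ y, c / 4 ≤ ‖y‖ → Ψr y = Real.exp (-(Φ y) / 2)) ∧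
      (∀ y ∈ {y : EuclideanSpace ℝ (Fin 3) | c / 4 < ‖y‖}, ∑ j, y j * pderiv j Ψr y = 0) ∧
      (∀ y ∈ {y : EuclideanSpace ℝ (Fin 3) | c / 4 < ‖y‖}, ∀ m,
        ∑ j, y j * pderiv j (pderiv m Ψr) y = -pderiv m Ψr y) ∧
      (∀ y ∈ {y : EuclideanSpace ℝ (Fin 3) | c / 4 < ‖y‖}, ∀ l m,
        ∑ j, y j * pderiv j (pderiv l (pderiv m Ψr)) y = -2 * pderiv l (pderiv m Ψr) y) ∧
      (∀ y ∈ {y : EuclideanSpace ℝ (Fin 3) | c / 4 < ‖y‖},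
        (∑ i, y i ^ 2) * (Ψr y * ∑ l, pderiv l (pderiv l Ψr) y - ∑ l, pderiv l Ψr y ^ 2) +
          Ψr y ^ 2 = 1) ∧
      (∀ y ∈ {y : EuclideanSpace ℝ (Fin 3) | c / 4 < ‖y‖}, ∀ j,
        2 * y j * (Ψr y * (∑ l, pderiv l (pderiv l Ψr) y) - ∑ l, pderiv l Ψr y ^ 2) +
          (∑ i, y i ^ 2) * (pderiv j Ψr y * (∑ l, pderiv l (pderiv l Ψr) y) +
            Ψr y * (∑ l, pderiv j (pderiv l (pderiv l Ψr)) y) -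
            2 * ∑ l, pderiv l Ψr y * pderiv j (pderiv l Ψr) y) +
          2 * Ψr y * pderiv j Ψr y = 0) := by
  -- the bulk `f`-equation constant (only needed to call `conformal_setup`; its value is irrelevant)
  obtain ⟨k₀, -, -, hFeq⟩ := bernoulliK_const_and_radVort_eq_zero hu hp hns hdiv hhom rfl rfl rfl
  obtain ⟨U, R, Φr, hU, hR, hΦr, hUu, hRr, hΦrΦ, hEuU, hdivU, hR1, -, hgradΦ⟩ :=
    conformal_setup hu hp hns hdiv hhom hΦs hΦ hFeq hc
  have hδ : 0 < c / 4 := by positivity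
  have hS := isOpen_lt_norm (c / 4)
  set Ψr : EuclideanSpace ℝ (Fin 3) → ℝ := fun y => Real.exp (-(Φr y) / 2) with hΨr
  have hΨc : ContDiff ℝ ∞ Ψr := (hΦr.neg.div_const 2).exp
  have hΨpos : ∀ y, 0 < Ψr y := fun y => Real.exp_pos _
  have hΨ0 : ∀ y, Ψr y ≠ 0 := fun y => (hΨpos y).ne'
  have hΨd : Differentiable ℝ Ψr := hΨc.differentiable (by simp)
  -- `Φr = −2 log Ψr`
  have hΦlog : Φr = fun y => -2 * Real.log (Ψr y) := by
    funext y; simp only [hΨr, Real.log_exp]; ring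
  set F : EuclideanSpace ℝ (Fin 3) → ℝ := fun y => ∑ i, y i * U y i with hFdef
  set Vt : EuclideanSpace ℝ (Fin 3) → EuclideanSpace ℝ (Fin 3) := fun y => U y - (F y * R y) • y
    with hVdef
  have huU : EqOn u U {y | c / 4 < ‖y‖} := fun y hy => (hUu y (le_of_lt hy)).symm
  -- (R0) Euler for `Ψr`: `DΨr(y) y = −½Ψr DΦr(y) y = −½Ψr ⟪Vt y, y⟫ = 0`
  have hE0 : ∀ y ∈ {y : EuclideanSpace ℝ (Fin 3) | c / 4 < ‖y‖}, ∑ j, y j * pderiv j Ψr y = 0 := by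
    intro y hy
    rw [← fderiv_apply_eq_sum_mul_pderiv]
    have hΦrd : Differentiable ℝ Φr := hΦr.differentiable (by simp)
    have hΨr' : Ψr = fun y => Real.exp ((-2⁻¹ : ℝ) * Φr y) := by
      funext y; simp only [hΨr]; ring_nf
    have h1 : HasFDerivAt (fun y => Real.exp ((-2⁻¹ : ℝ) * Φr y))
        (Real.exp ((-2⁻¹ : ℝ) * Φr y) • ((-2⁻¹ : ℝ) • fderiv ℝ Φr y)) y :=
      (((hΦrd y).hasFDerivAt).const_mul (-2⁻¹ : ℝ)).exp
    rw [hΨr', h1.fderiv]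
    simp only [FunLike.coe_smul, Pi.smul_apply, smul_eq_mul]
    have h3 : fderiv ℝ Φr y y = ⟪gradient Φr y, y⟫ := (inner_gradient_left).symm
    rw [h3, hgradΦ y hy, real_inner_comm,
      inner_tangentialReg_on (F := F) (Vt := Vt) hR1 rfl rfl hy]
    ring
  -- (R1), (R2) by differentiating Euler's relation
  have hE1 : ∀ y ∈ {y : EuclideanSpace ℝ (Fin 3) | c / 4 < ‖y‖}, ∀ m,
      ∑ j, y j * pderiv j (pderiv m Ψr) y = -pderiv m Ψr y := by
    intro y hy m
    have := euler_pderiv hΨc hS (k := 0) (fun z hz => by rw [hE0 z hz, zero_mul]) m hy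
    rw [this]; ring
  have hE2 : ∀ y ∈ {y : EuclideanSpace ℝ (Fin 3) | c / 4 < ‖y‖}, ∀ l m,
      ∑ j, y j * pderiv j (pderiv l (pderiv m Ψr)) y = -2 * pderiv l (pderiv m Ψr) y := by
    intro y hy l m
    have := euler_pderiv (contDiff_pderiv hΨc m) hS (k := -1)
      (fun z hz => by rw [hE1 z hz m]; ring) l hy
    rw [this]; ring
  -- (R3) the Liouville equation
  have hPDE : ∀ y ∈ {y : EuclideanSpace ℝ (Fin 3) | c / 4 < ‖y‖},
      (∑ i, y i ^ 2) * (Ψr y * ∑ l, pderiv l (pderiv l Ψr) y - ∑ l, pderiv l Ψr y ^ 2) +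
        Ψr y ^ 2 = 1 := by
    intro y hy
    have hy0 := ne_zero_of_lt_norm hδ hy
    -- `div Vt = −F R` and `div Vt = div ∇Φr = ∑ ∂ₗ∂ₗΦr`
    have hd1 : VectorCalculus.divergence Vt y = -(F y * R y) :=
      divergence_tangentialReg_on hU hR hS hEuU hdivU hR1 rfl rfl hy
    have hgV : EqOn (gradient Φr) Vt {y | c / 4 < ‖y‖} := fun z hz => by
      rw [hgradΦ z hz]
    have hd2 : VectorCalculus.divergence Vt y = VectorCalculus.divergence (gradient Φr) y := by
      unfold VectorCalculus.divergence
      rw [(hgV.eventuallyEq_of_mem (hS.mem_nhds hy)).symm.fderiv_eq]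
    have hd3 : VectorCalculus.divergence (gradient Φr) y = ∑ l, pderiv l (pderiv l Φr) y :=
      divergence_gradient_eq_sum hΦr y
    -- `∑ ∂ₗ∂ₗΦr = −2 ∑ (Ψ⁻¹∂ₗ∂ₗΨ − Ψ⁻²(∂ₗΨ)²)`
    have hd4 : ∀ l, pderiv l (pderiv l Φr) y =
        -2 * (-((Ψr y) ^ 2)⁻¹ * pderiv l Ψr y * pderiv l Ψr y + (Ψr y)⁻¹ * pderiv l (pderiv l Ψr) y) := by
      intro l
      obtain ⟨h1, h2⟩ := pderiv_pderiv_log hΨc hΨ0 l y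
      have hlogd : Differentiable ℝ fun y => Real.log (Ψr y) := fun z => (hΨd z).log (hΨ0 z)
      rw [hΦlog, pderiv_const_mul (f := fun y => Real.log (Ψr y)) hlogd,
        pderiv_const_mul (f := pderiv l fun y => Real.log (Ψr y)) (by
          rw [h1]; exact (pderiv_inv_of_ne_zero (g := fun m => pderiv m Ψr) hΨc hΨ0
            (fun _ => rfl) l).1.mul ((contDiff_pderiv hΨc l).differentiable (by simp)))]
      beta_reduce
      rw [h2]
    -- `F = 2e^{Φr} − 2 = 2Ψ⁻² − 2` on the shell
    have hFy : F y = 2 * ((Ψr y) ^ 2)⁻¹ - 2 := by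
      have h1 := hΦF y hy0
      have h2 : ⟪y, u y⟫ = F y := by
        simp only [hFdef, PiLp.inner_apply, RCLike.inner_apply, conj_trivial, huU hy]
        exact Finset.sum_congr rfl fun j _ => mul_comm _ _
      have h3 : Real.exp (Φ y) = ((Ψr y) ^ 2)⁻¹ := by
        rw [← hΦrΦ y (le_of_lt hy), hΨr]
        beta_reduce
        rw [← Real.exp_nat_mul, ← Real.exp_neg]
        congr 1; push_cast; ring
      rw [h2, h3] at h1
      linarith
    have hRy : R y = (∑ i, y i ^ 2)⁻¹ := hRr y (le_of_lt hy)
    have hr0 : (∑ i, y i ^ 2) ≠ 0 := by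
      rw [← EuclideanSpace.real_norm_sq_eq]; exact pow_ne_zero 2 (norm_ne_zero_iff.mpr hy0)
    have hP0 := hΨ0 y
    -- combine
    have key : ∑ l, pderiv l (pderiv l Φr) y = -(F y * R y) := by rw [← hd3, ← hd2, hd1]
    set P : ℝ := Ψr y with hPdef
    set A : ℝ := ∑ l, pderiv l Ψr y ^ 2 with hAdef
    set B : ℝ := ∑ l, pderiv l (pderiv l Ψr) y with hBdef
    set r2v : ℝ := ∑ i, y i ^ 2 with hr2v
    have hsum : ∑ l, (-((P) ^ 2)⁻¹ * pderiv l Ψr y * pderiv l Ψr y +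
        (P)⁻¹ * pderiv l (pderiv l Ψr) y) = -(P ^ 2)⁻¹ * A + P⁻¹ * B := by
      rw [Finset.sum_add_distrib, hAdef, hBdef, Finset.mul_sum, Finset.mul_sum]
      congr 1
      exact Finset.sum_congr rfl fun l _ => by ring
    rw [Finset.sum_congr rfl fun l _ => hd4 l, ← Finset.mul_sum, hsum, hFy, hRy] at key
    have hsq : (P ^ 2)⁻¹ = P⁻¹ * P⁻¹ := by rw [sq, mul_inv]
    rw [hsq] at key
    set Pi : ℝ := P⁻¹ with hPi
    set Ri : ℝ := r2v⁻¹ with hRi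
    have hPPi : P * Pi = 1 := mul_inv_cancel₀ hP0
    have hRRi : r2v * Ri = 1 := mul_inv_cancel₀ hr0
    linear_combination (-P ^ 2 * r2v / 2) * key +
      (r2v * A * (P * Pi + 1) - P * r2v * B + (P * Pi + 1) * r2v * Ri) * hPPi +
      (1 - P ^ 2) * hRRi
  -- (R4) its derivative along `eⱼ`
  have hPDE' : ∀ y ∈ {y : EuclideanSpace ℝ (Fin 3) | c / 4 < ‖y‖}, ∀ j,
      2 * y j * (Ψr y * (∑ l, pderiv l (pderiv l Ψr) y) - ∑ l, pderiv l Ψr y ^ 2) +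
        (∑ i, y i ^ 2) * (pderiv j Ψr y * (∑ l, pderiv l (pderiv l Ψr) y) +
          Ψr y * (∑ l, pderiv j (pderiv l (pderiv l Ψr)) y) -
          2 * ∑ l, pderiv l Ψr y * pderiv j (pderiv l Ψr) y) +
        2 * Ψr y * pderiv j Ψr y = 0 := by
    intro y hy j
    set Lf : EuclideanSpace ℝ (Fin 3) → ℝ := fun y => ∑ l, pderiv l (pderiv l Ψr) y with hLf
    set Gf : EuclideanSpace ℝ (Fin 3) → ℝ := fun y => ∑ l, pderiv l Ψr y ^ 2 with hGf
    have hLd : Differentiable ℝ Lf :=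
      Differentiable.fun_sum fun l _ => (contDiff_pderiv₂ hΨc l l).differentiable (by simp)
    have hGd : Differentiable ℝ Gf :=
      Differentiable.fun_sum fun l _ => ((contDiff_pderiv hΨc l).differentiable (by simp)).pow 2
    have hin : Differentiable ℝ fun y => Ψr y * Lf y - Gf y := (hΨd.mul hLd).sub hGd
    have h0 := pderiv_eq_zero_of_eqOn_zero hS
      (f := fun y => (∑ i, y i ^ 2) * (Ψr y * Lf y - Gf y) + Ψr y ^ 2 - 1)
      (fun z hz => by have := hPDE z hz; simp only [hLf, hGf]; linarith) j hy
    rw [pderiv_sub (f := fun y => (∑ i, y i ^ 2) * (Ψr y * Lf y - Gf y) + Ψr y ^ 2)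
        (g := fun _ => (1 : ℝ)) ((differentiable_normSq.mul hin).add (hΨd.pow 2))
        (differentiable_const _),
      pderiv_add (f := fun y => (∑ i, y i ^ 2) * (Ψr y * Lf y - Gf y)) (g := fun y => Ψr y ^ 2)
        (differentiable_normSq.mul hin) (hΨd.pow 2),
      pderiv_mul (f := fun y => ∑ i, y i ^ 2) (g := fun y => Ψr y * Lf y - Gf y)
        differentiable_normSq hin,
      pderiv_sub (f := fun y => Ψr y * Lf y) (g := Gf) (hΨd.mul hLd) hGd,
      pderiv_mul hΨd hLd, pderiv_normSq, pderiv_const] at h0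
    have e1 : pderiv j (fun y => Ψr y ^ 2) y = 2 * Ψr y * pderiv j Ψr y := by
      have := congrFun (pderiv_pow hΨd 1 j) y
      simp only [pow_one, Nat.cast_one] at this
      rw [this]; ring
    have e2 : pderiv j Lf y = ∑ l, pderiv j (pderiv l (pderiv l Ψr)) y := by
      rw [pderiv_obataL (H := fun a b => pderiv a (pderiv b Ψr))
        (T := fun a b c => pderiv a (pderiv b (pderiv c Ψr))) hΨc (fun _ _ => rfl)
        (fun _ _ _ => rfl) rfl j]
    have e3 : pderiv j Gf y = 2 * ∑ l, pderiv l Ψr y * pderiv j (pderiv l Ψr) y := by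
      rw [pderiv_obataG (g := fun m => pderiv m Ψr) (H := fun a b => pderiv a (pderiv b Ψr)) hΨc
        (fun _ => rfl) (fun _ _ => rfl) rfl j]
    simp only [e1, e2, e3, sub_zero] at h0
    simp only [hLf, hGf] at h0
    linarith
  exact ⟨Ψr, hΨc, hΨ0, hΨpos, fun y hy => by show Real.exp (-(Φr y) / 2) = _; rw [hΦrΦ y hy],
    hE0, hE1, hE2, hPDE, hPDE'⟩

end Sverak2011

end Literature.Analysis.FluidPDE
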